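import Summits.CriticalPhenomena.CardyFormulaZ2.Theorems.CardyIKTransportIKMixedBoxCrossingTransportStubCylPlaneBand

/-!
# `CardyIKTransport.IKLinearTransport` (stmt-CriticalPhenomena-5076), line `pinned-diagram-exchange`, lead c8 —
# CYLINDER versus PLANE on a band, the LOWER direction: `qProb τ E ≤ 25/16 · cylProb (bandQ ⁻¹' E)`

Support file (`--supports stmt-CriticalPhenomena-5076`, registered sub-goal `qProb_le_cylProb_band`).  The sister line's
`CylPlane.cylProb_bandQ_le` (p-landed, `…TransportStubCylPlaneBand`) bounds the slab probability of a band event ABOVE by twice its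
planar free box probability; the same cut (`CylPlane.sum_off`) and the same two-sided `L∞` mixing of the row kernel
(`CylPlane.K_pow_ratio`: every entry of `K τ ^ (d'+1)` within the factor `5/4` of a reference value) bound it BELOW:
numerator `≥ (4/5) m · N_E`, partition function `≤ (5/4) m · qZ`, so `cylProb ≥ (16/25) · qProb`.  This is the direction needed to
turn cylinder LOWER bounds (wall domination, `…WallDomination.lean`) into planar lower bounds.
-/

noncomputable section

namespace Summit.CriticalPhenomena.CardyFormulaZ2.Theorems.IKLinearTransport.PinnedDiagramExchange.WallDomination

open scoped BigOperators Classical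
open Finset
open Summit.CriticalPhenomena.CardyFormulaZ2.Cruxes.IKMixedBoxCrossing.DefectClosureExploration
open CylPlane

/-- **CYLINDER versus PLANE on a band, lower direction** (registered sub-goal `qProb_le_cylProb_band`): for `L = h + 1 + d'` with
`d' ≥ 2w + 1`, the planar free box probability of an event read on the band of rows `0 … h` is at most `25/16` times its slab
probability. -/
theorem qProb_le_cylProb_band : ∀ {w L h d' : ℕ} [NeZero L], L = h + 1 + d' → 2 * w + 1 ≤ d' → ∀ (τ : Fin w → Bool)
    (E : Set (Q w h)), qProb τ E ≤ 25 / 16 * cylProb w L τ (bandQ L h ⁻¹' E) := by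
  intro w L h d' _ hL hd τ E
  have hnum : (∑ x : CylCfg w L, if x ∈ bandQ L h ⁻¹' E then cylWeight w L τ x else 0) =
      ∑ q : Q w h, if q ∈ E then qWt τ q * (K τ ^ (d' + 1)) (topRow q) (botRow q) else 0 := by
    rw [← (CylPlane.splitEquiv hL).symm.sum_comp, Fintype.sum_prod_type]
    refine Finset.sum_congr rfl fun q _ => ?_
    have hmem : ∀ o : Off w L h d', (glue hL q o ∈ bandQ L h ⁻¹' E) = (q ∈ E) := fun o => by
      rw [Set.mem_preimage, bandQ_glue]
    have e : ∀ o : Off w L h d', (CylPlane.splitEquiv hL).symm (q, o) = glue hL q o := fun o => rfl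
    simp only [e, hmem]
    split_ifs with hq
    · exact sum_off hL τ q
    · simp
  have hden : cylZ w L τ = ∑ q : Q w h, qWt τ q * (K τ ^ (d' + 1)) (topRow q) (botRow q) := by
    unfold cylZ
    rw [← (CylPlane.splitEquiv hL).symm.sum_comp, Fintype.sum_prod_type]
    exact Finset.sum_congr rfl fun q _ => sum_off hL τ q
  set m := (K τ ^ (d' + 1)) (fun _ => false) (fun _ => false) with hm
  have hK : ∀ u v : Row w, (K τ ^ (d' + 1)) u v ≤ 5 / 4 * m ∧ m ≤ 5 / 4 * (K τ ^ (d' + 1)) u v := fun u v =>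
    ⟨(K_pow_ratio τ (d' + 1) (by omega) u v _ _).2, (K_pow_ratio τ (d' + 1) (by omega) _ _ u v).2⟩
  have hm0 : 0 < m := (K_pow_ratio τ (d' + 1) (by omega) _ _ (fun _ => false) (fun _ => false)).1
  set NE := ∑ q : Q w h, if q ∈ E then qWt τ q else 0 with hNE
  have hNE0 : 0 ≤ NE := Finset.sum_nonneg fun q _ => by split_ifs; exacts [qWt_nonneg τ q, le_rfl]
  -- numerator from below
  have hN : 4 / 5 * m * NE ≤
      ∑ q : Q w h, if q ∈ E then qWt τ q * (K τ ^ (d' + 1)) (topRow q) (botRow q) else 0 := by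
    rw [hNE, Finset.mul_sum]
    refine Finset.sum_le_sum fun q _ => ?_
    split_ifs
    · calc 4 / 5 * m * qWt τ q = qWt τ q * (4 / 5 * m) := by ring
        _ ≤ qWt τ q * _ := mul_le_mul_of_nonneg_left (by linarith [(hK (topRow q) (botRow q)).2]) (qWt_nonneg τ q)
    · simp
  -- partition function from above
  have hZ : (∑ q : Q w h, qWt τ q * (K τ ^ (d' + 1)) (topRow q) (botRow q)) ≤ 5 / 4 * m * qZ τ h := by
    unfold qZ
    rw [Finset.mul_sum]
    refine Finset.sum_le_sum fun q _ => ?_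
    calc qWt τ q * _ ≤ qWt τ q * (5 / 4 * m) := mul_le_mul_of_nonneg_left (hK _ _).1 (qWt_nonneg τ q)
      _ = 5 / 4 * m * qWt τ q := by ring
  have hqZ := qZ_pos (w := w) τ h
  have hKpos : ∀ u v : Row w, 0 < (K τ ^ (d' + 1)) u v := fun u v =>
    (K_pow_ratio τ (d' + 1) (by omega) u v (fun _ => false) (fun _ => false)).1
  have hZpos : 0 < ∑ q : Q w h, qWt τ q * (K τ ^ (d' + 1)) (topRow q) (botRow q) :=
    Finset.sum_pos' (fun q _ => mul_nonneg (qWt_nonneg τ q) (hKpos _ _).le)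
      ⟨((fun _ => false), (fun _ => true)), Finset.mem_univ _, mul_pos
        (Finset.prod_pos fun p _ => by unfold faceWeight qpar; cases τ p.1 <;> norm_num) (hKpos _ _)⟩
  unfold cylProb qProb
  rw [hnum, hden, div_le_iff₀ hqZ]
  rw [show 25 / 16 * ((∑ q : Q w h, if q ∈ E then qWt τ q * (K τ ^ (d' + 1)) (topRow q) (botRow q) else 0) /
      ∑ q : Q w h, qWt τ q * (K τ ^ (d' + 1)) (topRow q) (botRow q)) * qZ τ h =
      25 / 16 * (∑ q : Q w h, if q ∈ E then qWt τ q * (K τ ^ (d' + 1)) (topRow q) (botRow q) else 0) * qZ τ h /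
      ∑ q : Q w h, qWt τ q * (K τ ^ (d' + 1)) (topRow q) (botRow q) by ring]
  rw [le_div_iff₀ hZpos, ← hNE]
  -- `NE · Z_cyl ≤ NE · (5/4 m qZ)` and `25/16 · N_cyl · qZ ≥ 25/16 · (4/5 m NE) qZ = 5/4 m NE qZ`
  calc NE * ∑ q : Q w h, qWt τ q * (K τ ^ (d' + 1)) (topRow q) (botRow q)
      ≤ NE * (5 / 4 * m * qZ τ h) := mul_le_mul_of_nonneg_left hZ hNE0
    _ = 25 / 16 * (4 / 5 * m * NE) * qZ τ h := by ring
    _ ≤ 25 / 16 * (∑ q : Q w h, if q ∈ E then qWt τ q * (K τ ^ (d' + 1)) (topRow q) (botRow q) else 0) * qZ τ h :=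
        mul_le_mul_of_nonneg_right (mul_le_mul_of_nonneg_left hN (by norm_num)) hqZ.le

end Summit.CriticalPhenomena.CardyFormulaZ2.Theorems.IKLinearTransport.PinnedDiagramExchange.WallDomination

end
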